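import Summits.Parity.BatemanHorn.Theorems.SoloInformedTrapezoidDyadic

/-!
# The trapezoid method: cancellation from the local `ℓ¹`-mean hypothesis, and Erdős's asymptotics

Ledger: this work (soloist programme `solo-Parity-informed`, the `d ≥ 3` rung below the parity wall).

We sum the uniform block bound of `SoloInformedTrapezoidUniform` over the `O(log X₁)` dyadic blocks of the modulus
range of the trapezoid form (`SoloInformedTrapezoidDyadic`) and compare with `ε·D·X₀ log X₀`.

Main results:
* `trapezoidCancellation_of_hooleyMeanLocal`: for `g` irreducible of degree `d ≥ 2`, `Δ > 0`,
  `2 − 4/d < θ ≤ 1`, `1 − 2/d < η`: `HooleyMeanLocal g θ η → TrapezoidCancellation g Δ`;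
* `erdosDivisorSumAsymptotic_of_hooleyMeanLocal`: for `d ≥ 3` moreover `→ ErdosDivisorSumAsymptotic g`
  (by the trapezoid reduction `erdosDivisorSumAsymptotic_of_trapezoidCancellation`).  The hypothesis is
  non-vacuous for `d = 3`: `θ ∈ (2/3, 1]`, `η > 1/3` (`erdosDivisorSumAsymptotic_cubic_of_hooleyMeanLocal`) — a
  power saving `E^{1−η}`, `η > 1/3`, ON AVERAGE over the frequencies `1 ≤ |h| ≤ H ≤ E^θ` and over a dyadic block
  of moduli, for the UNSHIFTED Hooley sums `S_g(h; e) = ∑_{g(ν) ≡ 0 (e)} e(hν/e)` of an irreducible cubic `g`,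
  gives `∑_{n ≤ x} τ(g(n)) ~ 3·A_g·x log x`.  Compared with `erdosDivisorSumAsymptotic_of_hooleyShiftUniform`
  the hypothesis has no shifts `b`, no supremum over `h`, and only the frequencies `|h| ≤ E^θ`.
-/

namespace Summit.Parity.BatemanHorn.Theorems

open Finset Polynomial

set_option maxHeartbeats 400000 in
/-- **Trapezoid cancellation from the local `ℓ¹`-mean hypothesis.**  For `g` irreducible of degree `d ≥ 2`,
`Δ > 0`, `2 − 4/d < θ ≤ 1` and `1 − 2/d < η`: `HooleyMeanLocal g θ η → TrapezoidCancellation g Δ`. [this work] -/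
theorem trapezoidCancellation_of_hooleyMeanLocal {g : ℤ[X]} (hirr : Irreducible g) (hdeg : 2 ≤ g.natDegree)
    {Δ : ℝ} (hΔ : 0 < Δ) {θ η : ℝ} (hθ : 2 - 4 / (g.natDegree : ℝ) < θ) (hθ1 : θ ≤ 1)
    (hη : 1 - 2 / (g.natDegree : ℝ) < η) (hml : HooleyMeanLocal g θ η) : TrapezoidCancellation g Δ := by
  set d : ℕ := g.natDegree with hd
  have hd2 : (2 : ℝ) ≤ d := by exact_mod_cast hdeg
  have hdpos : (0 : ℝ) < d := by linarith
  -- WLOG `η ≤ 1`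
  set η₁ : ℝ := min η 1 with hη₁
  have hη₁1 : η₁ ≤ 1 := min_le_right _ _
  have h2d : 0 < 2 / (d : ℝ) := by positivity
  have h2d1 : 2 / (d : ℝ) ≤ 1 := by rw [div_le_one hdpos]; exact hd2
  have hη₁lo : 1 - 2 / (d : ℝ) < η₁ := lt_min hη (by linarith)
  have hθ0 : 0 ≤ θ := by
    have : 4 / (d : ℝ) ≤ 2 := by rw [div_le_iff₀ hdpos]; linarith
    linarith
  obtain ⟨C, hC0, hC⟩ := (hml.mono_right (min_le_left η 1)).exists_nonneg
  obtain ⟨K, x₁, hK0, hK⟩ := exists_trapBlock_uniform hirr hdeg hΔ hC0 hθ1 hC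
  obtain ⟨B, hB⟩ := exists_abs_log_natAbs_eval_sub_le (g := g) (by omega)
  have hz : ∀ k : ℕ, g.eval (k : ℤ) ≠ 0 := eval_natCast_ne_zero_of_irreducible hirr hdeg
  clear hC hml
  -- the exponent `κ`
  set κ : ℝ := min (1 - (d : ℝ) / 2 * (1 - η₁)) (min (2 - (d : ℝ) / 2 * (2 - θ)) (η₁ + 2 / (d : ℝ) - 1))
    with hκ
  have hκ0 : 0 < κ := trapKappa_pos hdpos hθ hη₁lo
  have hκle₁ : κ ≤ 1 - (d : ℝ) / 2 * (1 - η₁) := min_le_left _ _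
  have hκle₂ : κ ≤ 2 - (d : ℝ) / 2 * (2 - θ) := (min_le_right _ _).trans (min_le_left _ _)
  have hκle₃ : κ ≤ η₁ + 2 / (d : ℝ) - 1 := (min_le_right _ _).trans (min_le_right _ _)
  -- constants
  set KU : ℝ := Real.exp Δ * Real.exp (B / 2) with hKU
  have hKU1 : 1 ≤ KU := by
    have h1 : 1 ≤ Real.exp Δ := by have := Real.add_one_le_exp Δ; linarith
    have h2 : 1 ≤ Real.exp (B / 2) := by
      have hB0 : 0 ≤ B := by have h := hB 1 le_rfl; norm_num at h; exact (abs_nonneg _).trans h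
      have := Real.add_one_le_exp (B / 2); linarith
    nlinarith
  set cL : ℝ := 2 + Real.log KU + (d : ℝ) / 2 with hcL
  have hlogKU : 0 ≤ Real.log KU := Real.log_nonneg hKU1
  have hcL0 : 0 ≤ cL := by positivity
  set Kf : ℝ := K * KU ^ (2 : ℝ) * (2 * cL + 1) * (cL + 1) with hKf
  have hKf0 : 0 ≤ Kf := by positivity
  intro δ hδ hδ1 ε hε
  -- the `o(1)`: `(log x)² ≤ (c₁/4) x^κ` for `x ≥ a`
  set c₁ : ℝ := ε / (2 * Kf * (2 / δ + 1) + 1) with hc₁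
  have hQ0 : 0 ≤ 2 * Kf * (2 / δ + 1) := by positivity
  have hc₁0 : 0 < c₁ := by positivity
  have hc₁le : 2 * Kf * (2 / δ + 1) * c₁ ≤ ε := by
    rw [hc₁, mul_div_assoc', div_le_iff₀ (by positivity)]
    nlinarith
  obtain ⟨a, ha⟩ := Filter.eventually_atTop.mp
    ((isLittleO_log_rpow_rpow_atTop 2 hκ0).def (by positivity : 0 < c₁ / 4))
  refine ⟨max x₁ (max 3 ⌈a⌉₊), fun X₀ D hx₀ hδD hDX => ?_⟩
  have hx₁X : x₁ ≤ X₀ := le_trans (le_max_left _ _) hx₀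
  have h3X : 3 ≤ X₀ := le_trans ((le_max_left _ _).trans (le_max_right _ _)) hx₀
  have haX : ⌈a⌉₊ ≤ X₀ := le_trans ((le_max_right _ _).trans (le_max_right _ _)) hx₀
  set Xr : ℝ := ((X₀ + D : ℕ) : ℝ) with hXr
  have hX₀r3 : (3 : ℝ) ≤ X₀ := by exact_mod_cast h3X
  have hDr : (D : ℝ) ≤ X₀ := by exact_mod_cast hDX
  have hXrX : Xr = (X₀ : ℝ) + D := by rw [hXr]; push_cast; ring
  have hD0 : (0 : ℝ) ≤ D := Nat.cast_nonneg D
  have hXr1 : (1 : ℝ) ≤ Xr := by rw [hXrX]; linarith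
  have hXr3 : (3 : ℝ) ≤ Xr := by rw [hXrX]; linarith
  have hXr0 : 0 < Xr := by linarith
  have hXr2 : Xr ≤ 2 * X₀ := by rw [hXrX]; linarith
  have haXr : a ≤ Xr := by
    have h1 : (⌈a⌉₊ : ℝ) ≤ X₀ := by exact_mod_cast haX
    have h2 := Nat.le_ceil a
    rw [hXrX]; linarith
  -- the dyadic bound at `U₀ = K_U X₁^{d/2}`
  set U₀ : ℝ := KU * Xr ^ ((d : ℝ) / 2) with hU₀
  have hU₀X : Xr ≤ U₀ := by
    have h1 : Xr ≤ Xr ^ ((d : ℝ) / 2) := by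
      have := Real.rpow_le_rpow_of_exponent_le hXr1 (show (1 : ℝ) ≤ (d : ℝ) / 2 by linarith)
      rwa [Real.rpow_one] at this
    exact h1.trans (le_mul_of_one_le_left (by positivity) hKU1)
  have hZ := norm_trapSum_le_dyadic g hΔ hz hB hK0 (by linarith) (by linarith) (by linarith) (by linarith)
    (fun E E' hE hEE' hE'2 => hK X₀ D E E' (by omega) hDX hE hEE' hE'2) (by omega)
    (show Real.exp Δ * Real.exp (B / 2) * Xr ^ ((d : ℝ) / 2) ≤ U₀ from le_rfl) hU₀X
  refine hZ.trans ?_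
  clear hZ hK
  have hB1 := trapBmax_le (D := (D : ℝ)) hK0 hKU1 hXr1 hD0 hdpos hη₁1 hθ1 hθ0 h2d1 hκ0.le
    hκle₁ hκle₂ hκle₃
  have hJ1 := natLog_le_of_le_pow hKU1 hXr1 hdpos.le (Nat.floor_le (by positivity : 0 ≤ U₀))
  set L₁ : ℝ := 1 + Real.log Xr with hL₁
  have hlogXr : 0 ≤ Real.log Xr := Real.log_nonneg hXr1
  have hL₁1 : 1 ≤ L₁ := by rw [hL₁]; linarith
  have hS0 : 0 ≤ Xr ^ (2 - κ) + D * Xr ^ (1 - κ) := by positivity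
  have hBm0 : 0 ≤ K * ((2 + Real.log U₀) * (Xr * U₀ ^ (1 - η₁) + Xr * D * Xr ^ (1 - η₁ - 2 / d))
      + U₀ ^ (2 - θ) + D * U₀ ^ (2 - θ - 2 / d)) := by
    have : 0 ≤ Real.log U₀ := Real.log_nonneg (hXr1.trans hU₀X)
    positivity
  have hJB : ((Nat.log 2 ⌊U₀⌋₊ : ℝ) + 1)
        * (K * ((2 + Real.log U₀) * (Xr * U₀ ^ (1 - η₁) + Xr * D * Xr ^ (1 - η₁ - 2 / d))
          + U₀ ^ (2 - θ) + D * U₀ ^ (2 - θ - 2 / d)))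
      ≤ Kf * L₁ ^ 2 * (Xr ^ (2 - κ) + D * Xr ^ (1 - κ)) := by
    have h1 : cL * L₁ + 1 ≤ (cL + 1) * L₁ := by nlinarith
    calc _ ≤ ((2 * cL + 1) * L₁) * (K * KU ^ (2 : ℝ) * (cL * L₁ + 1) * (Xr ^ (2 - κ) + D * Xr ^ (1 - κ))) :=
          mul_le_mul hJ1 hB1 hBm0 (by positivity)
      _ = K * KU ^ (2 : ℝ) * (2 * cL + 1) * L₁ * (Xr ^ (2 - κ) + D * Xr ^ (1 - κ)) * (cL * L₁ + 1) := by
          ring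
      _ ≤ K * KU ^ (2 : ℝ) * (2 * cL + 1) * L₁ * (Xr ^ (2 - κ) + D * Xr ^ (1 - κ)) * ((cL + 1) * L₁) :=
          mul_le_mul_of_nonneg_left h1 (by positivity)
      _ = Kf * L₁ ^ 2 * (Xr ^ (2 - κ) + D * Xr ^ (1 - κ)) := by rw [hKf]; ring
  refine hJB.trans ?_
  clear hJB hB1 hJ1 hBm0
  -- the `o(1)` and the final comparison
  have hlo : L₁ ^ 2 ≤ c₁ * Xr ^ κ := by
    have h := ha Xr haXr
    rw [Real.rpow_two, Real.norm_of_nonneg (sq_nonneg _), Real.norm_of_nonneg (by positivity)] at h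
    exact one_add_log_sq_le hXr3 h
  exact trapFinal_le hKf0 hXr0 hδ hε hc₁0.le hX₀r3 hD0 hδD hXr2 hlo hc₁le

/-- **ERDŐS'S ASYMPTOTICS FROM THE LOCAL `ℓ¹`-MEAN HYPOTHESIS.**  For `g` irreducible of degree `d ≥ 3`,
`2 − 4/d < θ ≤ 1`, `1 − 2/d < η`:  `HooleyMeanLocal g θ η → ErdosDivisorSumAsymptotic g`, i.e. a power saving
`E^{1−η}` on average over the frequencies `1 ≤ |h| ≤ E^θ` and over a dyadic block of moduli for the UNSHIFTED Hooley
sums `S_g(h; e)` gives `∑_{n≤x} τ(g(n)) ~ d·A_g·x log x`.  Non-vacuous exactly for cubics: `θ ∈ (2/3, 1]`, `η > 1/3`.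
[this work] -/
theorem erdosDivisorSumAsymptotic_of_hooleyMeanLocal {g : ℤ[X]} (hirr : Irreducible g)
    (hdeg : 3 ≤ g.natDegree) {θ η : ℝ} (hθ : 2 - 4 / (g.natDegree : ℝ) < θ) (hθ1 : θ ≤ 1)
    (hη : 1 - 2 / (g.natDegree : ℝ) < η) (hml : HooleyMeanLocal g θ η) : ErdosDivisorSumAsymptotic g :=
  erdosDivisorSumAsymptotic_of_trapezoidCancellation hirr hdeg one_pos
    (trapezoidCancellation_of_hooleyMeanLocal hirr (by omega) one_pos hθ hθ1 hη hml)

/-- The cubic case spelled out: for an irreducible cubic `g`, `θ ∈ (2/3, 1]` and `η > 1/3`,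
`HooleyMeanLocal g θ η → ErdosDivisorSumAsymptotic g`. [this work] -/
theorem erdosDivisorSumAsymptotic_cubic_of_hooleyMeanLocal {g : ℤ[X]} (hirr : Irreducible g)
    (hdeg : g.natDegree = 3) {θ η : ℝ} (hθ : 2 / 3 < θ) (hθ1 : θ ≤ 1) (hη : 1 / 3 < η)
    (hml : HooleyMeanLocal g θ η) : ErdosDivisorSumAsymptotic g :=
  erdosDivisorSumAsymptotic_of_hooleyMeanLocal hirr hdeg.ge (by rw [hdeg]; push_cast; linarith) hθ1
    (by rw [hdeg]; push_cast; linarith) hml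

end Summit.Parity.BatemanHorn.Theorems
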